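import Summits.AtomisticToContinuum.BoseEinsteinCondensation.Theorems.BECHeatBathGapSquareSummableInfluencePairFactorisation
import Summits.AtomisticToContinuum.BoseEinsteinCondensation.Theorems.BECHeatBathGapSquareSummableInfluenceLeastSquaresLeaf
import HarnessLib

/-!
# Route `BECHeatBathGap`, crux `SquareSummableInfluence` (stmt-AtomisticToContinuum-14368), line `registered`:
# the physics leaf in PAIR-FACTORISATION form (equivalence with skeleton v4's stub, and the crux by name)

Supports (does not close) stmt-AtomisticToContinuum-14368 (lead c6). Sequel of
`…SquareSummableInfluencePairFactorisation.lean` (`pairFactorisation_le_four_mul_leastSquares`: Bose symmetry of the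
`(N+1)`-body state turns a small least-squares single-bath-particle influence into the fibrewise pair factorisation
`Ψ(y, x_i, X̂) ≈ c(X̂) Θ(y, X̂) Θ(x_i, X̂)` at four times the cost):

* `leastSquares_le_pairApprox` — the converse direction (lead c5's least-squares lemma with the blind predictor
  `c(Z) Θ(tail Z^{i→y})`);
* `leastSquaresInfluence_iff_pairFactorisation` — the registered stub `stub_leastSquaresInfluence` (skeleton v4,
  verbatim) is EQUIVALENT to its pair-factorisation form: for every `N`-body ground state `Θ₀` some `(N+1)`-body
  ground state `Ψ₀` and measurable pair coefficients `c_i(X̂)` (blind to `y` and to `x_i`) with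
  `∑_i ∫_{Λ^{N+1}} |Ψ₀(Z) − c_i(Z) Θ₀(tail Z^{i→y}) Θ₀(tail Z)|² ≤ ε`;
* `squareSummableInfluence_of_pairFactorisationForm` — that form implies the crux `SquareSummableInfluence` BY NAME.

So card A2 reads: bath particle by bath particle, the `(N+1)`-body Dirichlet ground state is the product of TWO
COPIES of the `N`-body ground state glued along the other `N − 1` bath particles, up to a square-summable error —
the state-level, one-pair-localised form of `E₀(N+1) + E₀(N−1) ≈ 2E₀(N)`. `[folklore]` (Hilbert-space geometry).
-/

noncomputable section

open MeasureTheory Filter Function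
open scoped ENNReal NNReal Topology ComplexConjugate InnerProductSpace

namespace Summit.AtomisticToContinuum.BoseEinsteinCondensation.Theorems.SquareSummableInfluence

open Literature.MathematicalPhysics.QuantumManyBody.BoseGas

/-! ### The converse comparison -/

/-- **Converse: the least-squares defect is below the defect of every pair approximant.** For any measurable
coefficient `c` blind to the bath particle `x_i`, the predictor `c(Z) Θ(tail Z^{i→y})` is blind to `x_i`, so lead
c5's least-squares lemma applies: `∫ |Ψ − g⋆_i Θ(tail)|² ≤ ∫ |Ψ − c Θ(tail Z^{i→y}) Θ(tail)|²`. [folklore] -/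
theorem leastSquares_le_pairApprox :
    ∀ (N : ℕ) (L : ℝ) (Θ : Config N → ℂ) (Ψ : Config (N + 1) → ℂ), Measurable Θ → Measurable Ψ →
      (∫⁻ X in boxN N L, (‖Θ X‖₊ : ℝ≥0∞) ^ 2) ≠ ⊤ →
      (∫⁻ Z in boxN (N + 1) L, (‖Ψ Z‖₊ : ℝ≥0∞) ^ 2) ≠ ⊤ → ∀ (i : Fin N) (c : Config (N + 1) → ℂ),
      Measurable c → (∀ Z a, c (Function.update Z (Fin.succ i) a) = c Z) →
    (∫⁻ Z in boxN (N + 1) L, (‖Ψ Z -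
        ((∫ x in box L, conj (Θ (Matrix.vecTail (Function.update Z (Fin.succ i) x))) *
            Ψ (Function.update Z (Fin.succ i) x)) /
          (((∫⁻ x in box L, (‖Θ (Matrix.vecTail (Function.update Z (Fin.succ i) x))‖₊ : ℝ≥0∞) ^ 2).toReal
            : ℝ) : ℂ)) *
          Θ (Matrix.vecTail Z)‖₊ : ℝ≥0∞) ^ 2) ≤
      ∫⁻ Z in boxN (N + 1) L, (‖Ψ Z -
          c Z * Θ (Matrix.vecTail (Function.update Z (Fin.succ i) (Z 0))) * Θ (Matrix.vecTail Z)‖₊ : ℝ≥0∞) ^ 2 := by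
  intro N L Θ Ψ hΘ hΨ hΘ2 hΨ2 i c hc hci
  have h0ne : (0 : Fin (N + 1)) ≠ Fin.succ i := (Fin.succ_ne_zero i).symm
  have hgm : Measurable fun Z : Config (N + 1) =>
      c Z * Θ (Matrix.vecTail (Function.update Z (Fin.succ i) (Z 0))) :=
    hc.mul (hΘ.comp (measurable_vecTail.comp
      ((measurable_update' (a := Fin.succ i)).comp (measurable_id.prodMk (measurable_pi_apply 0)))))
  have hgi : ∀ (Z : Config (N + 1)) (x : Space),
      c (Function.update Z (Fin.succ i) x) *
          Θ (Matrix.vecTail (Function.update (Function.update Z (Fin.succ i) x) (Fin.succ i)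
            (Function.update Z (Fin.succ i) x 0))) =
        c Z * Θ (Matrix.vecTail (Function.update Z (Fin.succ i) (Z 0))) := fun Z x => by
    rw [hci, Function.update_idem, Function.update_of_ne h0ne]
  have h := lintegral_sub_leastSquares_mul_tail_sq_le N L Θ Ψ hΘ hΨ hΘ2 hΨ2 i
    (fun Z => c Z * Θ (Matrix.vecTail (Function.update Z (Fin.succ i) (Z 0)))) hgm hgi
  simpa only [mul_assoc] using h

/-! ### The leaf in pair-factorisation form -/

/-- **The registered physics leaf `stub_leastSquaresInfluence` (skeleton v4) is EQUIVALENT to its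
PAIR-FACTORISATION form.** Left: the registered stub verbatim (total least-squares single-bath-particle
influence `≤ ε` for some `(N+1)`-body ground state `Ψ₀` over every `N`-body ground state `Θ₀`). Right: for every
`Θ₀` some `Ψ₀` and measurable pair coefficients `c_i`, blind to the inserted particle `y = Z 0` AND to the bath
particle `x_i`, with `∑_i ∫_{Λ^{N+1}} |Ψ₀(Z) − c_i(Z) Θ₀(tail Z^{i→y}) Θ₀(tail Z)|² ≤ ε` — bath particle by bath
particle, the `(N+1)`-body ground state is the product of TWO COPIES of the `N`-body ground state sharing the other
`N − 1` bath particles, `Ψ₀(y, x_i, X̂) ≈ c_i(X̂) Θ₀(y, X̂) Θ₀(x_i, X̂)`. `→` at tolerance `ε/4` by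
`pairFactorisation_le_four_mul_leastSquares` (ground states are Bose symmetric); `←` by `leastSquares_le_pairApprox`.
[folklore] -/
theorem leastSquaresInfluence_iff_pairFactorisation :
    (∀ v : ℝ → ℝ≥0∞, IsRepulsiveFiniteRange v → ∀ ε : ℝ, 0 < ε →
      ∃ ρ₀ : ℝ, 0 < ρ₀ ∧ ∀ ρ : ℝ, 0 < ρ → ρ < ρ₀ → ∀ᶠ N : ℕ in atTop,
        ∀ Θ₀ : Config N → ℂ, IsGroundState v (sideLength ρ (N + 1)) Θ₀ →
          ∃ Ψ₀ : Config (N + 1) → ℂ, IsGroundState v (sideLength ρ (N + 1)) Ψ₀ ∧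
            (∑ i : Fin N, ∫⁻ Z in boxN (N + 1) (sideLength ρ (N + 1)),
              (‖Ψ₀ Z -
                ((∫ x in box (sideLength ρ (N + 1)), conj (Θ₀ (Matrix.vecTail (Function.update Z (Fin.succ i) x))) *
                  Ψ₀ (Function.update Z (Fin.succ i) x)) /
                (((∫⁻ x in box (sideLength ρ (N + 1)),
                    (‖Θ₀ (Matrix.vecTail (Function.update Z (Fin.succ i) x))‖₊ : ℝ≥0∞) ^ 2).toReal : ℝ) : ℂ)) *
                  Θ₀ (Matrix.vecTail Z)‖₊ : ℝ≥0∞) ^ 2) ≤ ENNReal.ofReal ε) ↔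
    (∀ v : ℝ → ℝ≥0∞, IsRepulsiveFiniteRange v → ∀ ε : ℝ, 0 < ε →
      ∃ ρ₀ : ℝ, 0 < ρ₀ ∧ ∀ ρ : ℝ, 0 < ρ → ρ < ρ₀ → ∀ᶠ N : ℕ in atTop,
        ∀ Θ₀ : Config N → ℂ, IsGroundState v (sideLength ρ (N + 1)) Θ₀ →
          ∃ Ψ₀ : Config (N + 1) → ℂ, IsGroundState v (sideLength ρ (N + 1)) Ψ₀ ∧
          ∃ c : Fin N → Config (N + 1) → ℂ, (∀ i, Measurable (c i)) ∧
            (∀ i Z a, c i (Function.update Z 0 a) = c i Z) ∧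
            (∀ i Z a, c i (Function.update Z (Fin.succ i) a) = c i Z) ∧
            (∑ i : Fin N, ∫⁻ Z in boxN (N + 1) (sideLength ρ (N + 1)),
              (‖Ψ₀ Z - c i Z * Θ₀ (Matrix.vecTail (Function.update Z (Fin.succ i) (Z 0))) *
                Θ₀ (Matrix.vecTail Z)‖₊ : ℝ≥0∞) ^ 2) ≤ ENNReal.ofReal ε) := by
  -- square integrability on the boxes of ground states (they are normalised on the whole space)
  have hsq : ∀ {n : ℕ} {v : ℝ → ℝ≥0∞} {L : ℝ} {Φ : Config n → ℂ}, IsGroundState v L Φ →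
      ∫⁻ X in boxN n L, (‖Φ X‖₊ : ℝ≥0∞) ^ 2 ≠ ⊤ := fun hΦ =>
    ne_top_of_le_ne_top (by rw [hΦ.norm_eq]; exact ENNReal.one_ne_top) (setLIntegral_le_lintegral _ _)
  constructor
  · intro h v hv ε hε
    obtain ⟨ρ₀, hρ₀, H⟩ := h v hv (ε / 4) (by positivity)
    refine ⟨ρ₀, hρ₀, fun ρ hρ hρlt => ?_⟩
    filter_upwards [H ρ hρ hρlt] with N hN Θ₀ hΘ₀
    obtain ⟨Ψ₀, hΨ₀, hsum⟩ := hN Θ₀ hΘ₀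
    choose c hcm hc0 hci hcle using fun i : Fin N =>
      pairFactorisation_le_four_mul_leastSquares N (sideLength ρ (N + 1)) Θ₀ Ψ₀ hΘ₀.measurable
        hΨ₀.measurable (hsq hΘ₀) (hsq hΨ₀) i (fun Z => hΨ₀.symm _ Z)
    refine ⟨Ψ₀, hΨ₀, c, hcm, hc0, hci, ?_⟩
    calc (∑ i : Fin N, ∫⁻ Z in boxN (N + 1) (sideLength ρ (N + 1)),
            (‖Ψ₀ Z - c i Z * Θ₀ (Matrix.vecTail (Function.update Z (Fin.succ i) (Z 0))) *
              Θ₀ (Matrix.vecTail Z)‖₊ : ℝ≥0∞) ^ 2)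
        ≤ ∑ i : Fin N, 4 * ∫⁻ Z in boxN (N + 1) (sideLength ρ (N + 1)),
              (‖Ψ₀ Z -
                ((∫ x in box (sideLength ρ (N + 1)), conj (Θ₀ (Matrix.vecTail (Function.update Z (Fin.succ i) x))) *
                  Ψ₀ (Function.update Z (Fin.succ i) x)) /
                (((∫⁻ x in box (sideLength ρ (N + 1)),
                    (‖Θ₀ (Matrix.vecTail (Function.update Z (Fin.succ i) x))‖₊ : ℝ≥0∞) ^ 2).toReal : ℝ) : ℂ)) *
                  Θ₀ (Matrix.vecTail Z)‖₊ : ℝ≥0∞) ^ 2 := Finset.sum_le_sum fun i _ => hcle i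
      _ ≤ 4 * ENNReal.ofReal (ε / 4) := by
          rw [← Finset.mul_sum]
          gcongr
      _ = ENNReal.ofReal ε := by
          rw [← ENNReal.ofReal_ofNat, ← ENNReal.ofReal_mul (by norm_num)]
          congr 1
          ring
  · intro h v hv ε hε
    obtain ⟨ρ₀, hρ₀, H⟩ := h v hv ε hε
    refine ⟨ρ₀, hρ₀, fun ρ hρ hρlt => ?_⟩
    filter_upwards [H ρ hρ hρlt] with N hN Θ₀ hΘ₀
    obtain ⟨Ψ₀, hΨ₀, c, hcm, _, hci, hsum⟩ := hN Θ₀ hΘ₀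
    refine ⟨Ψ₀, hΨ₀, le_trans (Finset.sum_le_sum fun i _ => ?_) hsum⟩
    exact leastSquares_le_pairApprox N (sideLength ρ (N + 1)) Θ₀ Ψ₀ hΘ₀.measurable hΨ₀.measurable
      (hsq hΘ₀) (hsq hΨ₀) i (c i) (hcm i) (hci i)

/-- **The crux `SquareSummableInfluence` from the pair-factorisation leaf** (BY NAME): if at low density and
eventually in `N` every `N`-body Dirichlet ground state `Θ₀` in the box of side `((N+1)/ρ)^{1/3}` admits an
`(N+1)`-body ground state `Ψ₀` and pair coefficients `c_i(X̂)` with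
`∑_i ∫ |Ψ₀ − c_i Θ₀(tail Z^{i→y}) Θ₀(tail)|² ≤ ε`, then `SquareSummableInfluence` holds
(`leastSquaresInfluence_iff_pairFactorisation` then lead c5's `squareSummableInfluence_of_leastSquaresForm`).
[folklore] -/
theorem squareSummableInfluence_of_pairFactorisationForm :
    (∀ v : ℝ → ℝ≥0∞, IsRepulsiveFiniteRange v → ∀ ε : ℝ, 0 < ε →
      ∃ ρ₀ : ℝ, 0 < ρ₀ ∧ ∀ ρ : ℝ, 0 < ρ → ρ < ρ₀ → ∀ᶠ N : ℕ in atTop,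
        ∀ Θ₀ : Config N → ℂ, IsGroundState v (sideLength ρ (N + 1)) Θ₀ →
          ∃ Ψ₀ : Config (N + 1) → ℂ, IsGroundState v (sideLength ρ (N + 1)) Ψ₀ ∧
          ∃ c : Fin N → Config (N + 1) → ℂ, (∀ i, Measurable (c i)) ∧
            (∀ i Z a, c i (Function.update Z 0 a) = c i Z) ∧
            (∀ i Z a, c i (Function.update Z (Fin.succ i) a) = c i Z) ∧
            (∑ i : Fin N, ∫⁻ Z in boxN (N + 1) (sideLength ρ (N + 1)),
              (‖Ψ₀ Z - c i Z * Θ₀ (Matrix.vecTail (Function.update Z (Fin.succ i) (Z 0))) *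
                Θ₀ (Matrix.vecTail Z)‖₊ : ℝ≥0∞) ^ 2) ≤ ENNReal.ofReal ε) →
    Summit.AtomisticToContinuum.BoseEinsteinCondensation.Theses.BECHeatBathGap.SquareSummableInfluence :=
  fun h => squareSummableInfluence_of_leastSquaresForm (leastSquaresInfluence_iff_pairFactorisation.2 h)

end Summit.AtomisticToContinuum.BoseEinsteinCondensation.Theorems.SquareSummableInfluence

end
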